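import Literature.Probability.Process.NestedStoppedMartingales
import Mathlib.Topology.CompactOpen
import HarnessLib

/-!
# Continuity of the stopped clock `u ∧ τ` in the path, at paths leaving the level box cleanly

Topic `Literature/Probability/Process`; theorems only (no definition, no named fact). Companion of
`ContinuousHitting.lean` (via `NestedStoppedMartingales.lean`, for the stopped-clock lemma `coe_untopA_min`) (`exitTime u a b`, the first exit of a real process from the open interval
`(a, b)`).  On the path space `C([0, ∞), ℝ)` (compact-open = locally uniform topology) the exit time
of the canonical process, `τ(p) = exitTime (fun t p ↦ p t) a b p`, is NOT a continuous functional of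
the path: a path grazing the level `a` from inside and returning has neighbours exiting much later.
It is lower semicontinuous everywhere, and continuous exactly at the paths which, right after their
exit time, visit the complement of the CLOSED interval `[a, b]` ("clean" or transversal exit) — the
condition under which level-stopped martingale observables of lattice curves pass to the scaling
limit (Camia–Newman, PTRF 139 (2007), §5: crossing probabilities of the exploration path stopped on
reaching a level; Billingsley, *Convergence of Probability Measures* (1999), §2, continuity sets).
For every fixed path the levels of unclean exit are local-extremum values, a countable set; so for
a random continuous path all but countably many levels are almost surely clean.  This file proves
the deterministic half:

* `le_untopA_min_coe_of_coe_lt`, `untopA_min_coe_le_of_le_coe` — two inequalities for the stopped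
  clock `t ∧ c` read in `ℝ≥0` (`(min ↑t c).untopA`; cf. `coe_untopA_min` of
  `NestedStoppedMartingales.lean`);
* `eventually_coe_lt_exitTime_of_coe_lt` — LOWER SEMICONTINUITY: if `↑v < τ(p₀)` then `↑v < τ(p)`
  for all paths `p` near `p₀` (the image of `[0, v]` is a compact subset of the open interval, and
  `{p | p([0,v]) ⊆ (a,b)}` is a compact-open neighbourhood);
* `eventually_exitTime_le_of_apply_notMem_Icc` — if `p₀ s ∉ [a, b]` then `τ(p) ≤ s` near `p₀`;
* `continuousAt_untopA_min_exitTime` — at a path with a CLEAN exit (or no exit) the stopped clock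
  `p ↦ u ∧ τ(p)` is continuous, for every `u`;
* `continuousAt_stoppedClock`, `continuousAt_eval_stoppedClock` — joint continuity in `(u, p)` of
  the stopped clock and of the stopped value `p (u ∧ τ(p))` at `(u, p₀)` for such `p₀`.

## References

* F. Camia, C. M. Newman, *Critical percolation exploration path and SLE₆: a proof of
  convergence*, Probab. Theory Related Fields 139 (2007) 473–519, §5. [CamiaNewman2007]
* P. Billingsley, *Convergence of Probability Measures*, 2nd ed., Wiley (1999), §2.
  [Billingsley1999]
-/

noncomputable section

open MeasureTheory Filter Topology Set
open scoped NNReal ENNReal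

namespace Literature.Probability.Process

/-! ### The stopped clock `t ∧ c` read in `ℝ≥0` -/

section Clock

/-- If `↑v < c` then the clock stopped at `c` read at time `t ≥ v` is at least `v`. [folklore] -/
theorem le_untopA_min_coe_of_coe_lt {v t : ℝ≥0} (hvt : v ≤ t) {c : WithTop ℝ≥0}
    (h : (v : WithTop ℝ≥0) < c) : v ≤ (min (t : WithTop ℝ≥0) c).untopA := by
  rw [← WithTop.coe_le_coe, coe_untopA_min]
  exact le_min (WithTop.coe_le_coe.2 hvt) h.le

/-- If `c ≤ ↑s` then the clock stopped at `c` is at most `s`. [folklore] -/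
theorem untopA_min_coe_le_of_le_coe (t : ℝ≥0) {s : ℝ≥0} {c : WithTop ℝ≥0}
    (h : c ≤ (s : WithTop ℝ≥0)) : (min (t : WithTop ℝ≥0) c).untopA ≤ s := by
  rw [← WithTop.coe_le_coe, coe_untopA_min]
  exact (min_le_right _ _).trans h

end Clock

/-! ### The exit time of the canonical process on path space -/

section PathSpace

variable {a b : ℝ}

/-- **Lower semicontinuity of the exit time on path space.**  If the path `p₀` is still inside
`(a, b)` on `[0, v]` (`↑v < τ(p₀)`), then so is every path near `p₀` in the compact-open topology.
[cite: Billingsley1999, §2] -/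
theorem eventually_coe_lt_exitTime_of_coe_lt {p₀ : C(ℝ≥0, ℝ)} {v : ℝ≥0}
    (hv : (v : WithTop ℝ≥0) < exitTime (fun t (p : C(ℝ≥0, ℝ)) ↦ p t) a b p₀) :
    ∀ᶠ p in 𝓝 p₀, (v : WithTop ℝ≥0) < exitTime (fun t (q : C(ℝ≥0, ℝ)) ↦ q t) a b p := by
  -- `p₀` maps `[0, v]` into the open interval
  have hmaps : MapsTo p₀ (Icc 0 v) (Ioo a b) := fun s hs ↦
    mem_Ioo_of_coe_lt_exitTime (u := fun t (q : C(ℝ≥0, ℝ)) ↦ q t)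
      (lt_of_le_of_lt (WithTop.coe_le_coe.2 hs.2) hv)
  filter_upwards [ContinuousMap.eventually_mapsTo isCompact_Icc isOpen_Ioo hmaps] with p hp
  by_contra hle
  rw [not_lt] at hle
  obtain ⟨j, hj, hjmem⟩ := (exitTime_le_coe_iff (u := fun t (q : C(ℝ≥0, ℝ)) ↦ q t)
    (ω := p) p.continuous).1 hle
  exact hjmem (hp ⟨zero_le, hj⟩)

/-- If `p₀ s` lies outside the closed interval `[a, b]`, then every path near `p₀` has exited
`(a, b)` by time `s`. [folklore] -/
theorem eventually_exitTime_le_of_apply_notMem_Icc {p₀ : C(ℝ≥0, ℝ)} {s : ℝ≥0}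
    (hs : p₀ s ∉ Icc a b) :
    ∀ᶠ p in 𝓝 p₀, exitTime (fun t (q : C(ℝ≥0, ℝ)) ↦ q t) a b p ≤ s := by
  have hopen : IsOpen {p : C(ℝ≥0, ℝ) | p s ∈ (Icc a b)ᶜ} :=
    isClosed_Icc.isOpen_compl.preimage (continuous_eval_const s)
  filter_upwards [hopen.mem_nhds hs] with p hp
  refine (exitTime_le_coe_iff (u := fun t (q : C(ℝ≥0, ℝ)) ↦ q t) (ω := p) p.continuous).2
    ⟨s, le_rfl, fun h ↦ hp (Ioo_subset_Icc_self h)⟩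

/-- **Continuity of the stopped clock at a path with a clean exit.**  Let `τ` be the exit time of
the canonical process of `C([0, ∞), ℝ)` from `(a, b)`.  If the path `p₀` either never exits, or
exits at the finite time `T` CLEANLY — for every `ε > 0` there is `s ∈ (T, T + ε)` with
`p₀ s ∉ [a, b]` — then for every `u` the stopped clock `p ↦ u ∧ τ(p)` (read in `ℝ≥0`) is
continuous at `p₀`. [cite: CamiaNewman2007, §5] -/
theorem continuousAt_untopA_min_exitTime {p₀ : C(ℝ≥0, ℝ)}
    (hclean : ∀ T : ℝ≥0, exitTime (fun t (p : C(ℝ≥0, ℝ)) ↦ p t) a b p₀ = T →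
      ∀ ε : ℝ, 0 < ε → ∃ s : ℝ≥0, T < s ∧ (s : ℝ) < T + ε ∧ p₀ s ∉ Icc a b)
    (u : ℝ≥0) :
    ContinuousAt (fun p : C(ℝ≥0, ℝ) ↦
      (min (u : WithTop ℝ≥0) (exitTime (fun t (q : C(ℝ≥0, ℝ)) ↦ q t) a b p)).untopA) p₀ := by
  set τ : C(ℝ≥0, ℝ) → WithTop ℝ≥0 := fun p ↦ exitTime (fun t (q : C(ℝ≥0, ℝ)) ↦ q t) a b p with hτ
  set c : C(ℝ≥0, ℝ) → ℝ≥0 := fun p ↦ (min (u : WithTop ℝ≥0) (τ p)).untopA with hc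
  rw [ContinuousAt, Metric.tendsto_nhds]
  intro ε hε
  -- LOWER bound: eventually `c p > c p₀ - ε`
  have hlow : ∀ᶠ p in 𝓝 p₀, (c p₀ : ℝ) - ε < c p := by
    by_cases h0 : (c p₀ : ℝ) - ε < 0
    · exact Eventually.of_forall fun p ↦ h0.trans_le (c p).coe_nonneg
    · rw [not_lt] at h0
      -- `v = c p₀ - ε/2`, a time strictly before the exit of `p₀`
      set v : ℝ≥0 := ⟨(c p₀ : ℝ) - ε / 2, by linarith⟩ with hv
      have hvc : v < c p₀ := by
        rw [← NNReal.coe_lt_coe]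
        show (c p₀ : ℝ) - ε / 2 < c p₀
        linarith
      have hvu : v ≤ u := hvc.le.trans (untopA_min_coe_le u (τ p₀))
      have hvτ : (v : WithTop ℝ≥0) < τ p₀ :=
        lt_of_lt_of_le (WithTop.coe_lt_coe.2 hvc) ((coe_untopA_min u (τ p₀)).le.trans
          (min_le_right _ _))
      filter_upwards [eventually_coe_lt_exitTime_of_coe_lt hvτ] with p hp
      have : v ≤ c p := le_untopA_min_coe_of_coe_lt hvu hp
      have hv' : (v : ℝ) = c p₀ - ε / 2 := rfl
      calc (c p₀ : ℝ) - ε < c p₀ - ε / 2 := by linarith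
        _ = v := hv'.symm
        _ ≤ c p := NNReal.coe_le_coe.2 this
  -- UPPER bound: eventually `c p < c p₀ + ε`
  have hup : ∀ᶠ p in 𝓝 p₀, (c p : ℝ) < c p₀ + ε := by
    rcases lt_or_ge ((u : WithTop ℝ≥0)) (τ p₀) with hlt | hge
    · -- no exit before `u`: `c p₀ = u ≥ c p`
      have hcu : c p₀ = u := by
        show (min (u : WithTop ℝ≥0) (τ p₀)).untopA = u
        rw [min_eq_left hlt.le]; rfl
      refine Eventually.of_forall fun p ↦ ?_
      rw [hcu]
      have := NNReal.coe_le_coe.2 (untopA_min_coe_le u (τ p))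
      linarith
    · -- finite exit `T ≤ u`, clean: a time `s` just after `T` with `p₀ s ∉ [a, b]`
      obtain ⟨T, hT⟩ := WithTop.ne_top_iff_exists.1 (ne_top_of_le_ne_top WithTop.coe_ne_top hge)
      have hcT : c p₀ = T := by
        show (min (u : WithTop ℝ≥0) (τ p₀)).untopA = T
        rw [min_eq_right hge, ← hT]; rfl
      obtain ⟨s, hTs, hsε, hs⟩ := hclean T hT.symm ε hε
      filter_upwards [eventually_exitTime_le_of_apply_notMem_Icc hs] with p hp
      have h1 : c p ≤ s := untopA_min_coe_le_of_le_coe u hp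
      calc (c p : ℝ) ≤ s := NNReal.coe_le_coe.2 h1
        _ < T + ε := hsε
        _ = c p₀ + ε := by rw [hcT]
  filter_upwards [hlow, hup] with p h1 h2
  rw [NNReal.dist_eq]
  exact abs_sub_lt_iff.2 ⟨by linarith, by linarith⟩

/-- **Joint continuity of the stopped clock in time and path** at `(u, p₀)` for a path `p₀` with
a clean exit (the clock is `1`-Lipschitz in time). [folklore] -/
theorem continuousAt_stoppedClock {p₀ : C(ℝ≥0, ℝ)}
    (hclean : ∀ T : ℝ≥0, exitTime (fun t (p : C(ℝ≥0, ℝ)) ↦ p t) a b p₀ = T →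
      ∀ ε : ℝ, 0 < ε → ∃ s : ℝ≥0, T < s ∧ (s : ℝ) < T + ε ∧ p₀ s ∉ Icc a b)
    (u : ℝ≥0) :
    ContinuousAt (fun q : ℝ≥0 × C(ℝ≥0, ℝ) ↦
      (min (q.1 : WithTop ℝ≥0) (exitTime (fun t (r : C(ℝ≥0, ℝ)) ↦ r t) a b q.2)).untopA)
      (u, p₀) := by
  set τ : C(ℝ≥0, ℝ) → WithTop ℝ≥0 := fun p ↦ exitTime (fun t (q : C(ℝ≥0, ℝ)) ↦ q t) a b p with hτ
  rw [ContinuousAt, Metric.tendsto_nhds]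
  intro ε hε
  have h2 : ∀ᶠ p in 𝓝 p₀, dist (min (u : WithTop ℝ≥0) (τ p)).untopA
      (min (u : WithTop ℝ≥0) (τ p₀)).untopA < ε / 2 :=
    Metric.tendsto_nhds.1 (continuousAt_untopA_min_exitTime hclean u) (ε / 2) (half_pos hε)
  have h1 : ∀ᶠ v in 𝓝 u, dist v u < ε / 2 := Metric.ball_mem_nhds u (half_pos hε)
  filter_upwards [h1.prod_nhds h2] with q hq
  obtain ⟨hq1, hq2⟩ := hq
  calc dist (min (q.1 : WithTop ℝ≥0) (τ q.2)).untopA (min (u : WithTop ℝ≥0) (τ p₀)).untopA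
      ≤ dist (min (q.1 : WithTop ℝ≥0) (τ q.2)).untopA (min (u : WithTop ℝ≥0) (τ q.2)).untopA +
          dist (min (u : WithTop ℝ≥0) (τ q.2)).untopA (min (u : WithTop ℝ≥0) (τ p₀)).untopA :=
        dist_triangle _ _ _
    _ < ε / 2 + ε / 2 := add_lt_add_of_le_of_lt
        ((dist_untopA_min_coe_le (τ q.2) u q.1).trans hq1.le) hq2
    _ = ε := add_halves ε

/-- **Joint continuity of the stopped value `p (u ∧ τ(p))` in `(u, p)`** at `(u, p₀)` for a path
`p₀` with a clean exit (evaluation is jointly continuous on `C([0, ∞), ℝ) × [0, ∞)`).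
[cite: CamiaNewman2007, §5] -/
theorem continuousAt_eval_stoppedClock {p₀ : C(ℝ≥0, ℝ)}
    (hclean : ∀ T : ℝ≥0, exitTime (fun t (p : C(ℝ≥0, ℝ)) ↦ p t) a b p₀ = T →
      ∀ ε : ℝ, 0 < ε → ∃ s : ℝ≥0, T < s ∧ (s : ℝ) < T + ε ∧ p₀ s ∉ Icc a b)
    (u : ℝ≥0) :
    ContinuousAt (fun q : ℝ≥0 × C(ℝ≥0, ℝ) ↦
      q.2 (min (q.1 : WithTop ℝ≥0) (exitTime (fun t (r : C(ℝ≥0, ℝ)) ↦ r t) a b q.2)).untopA)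
      (u, p₀) := by
  have hev : Continuous fun z : C(ℝ≥0, ℝ) × ℝ≥0 ↦ z.1 z.2 := continuous_eval
  have h1 : ContinuousAt (fun q : ℝ≥0 × C(ℝ≥0, ℝ) ↦
      (q.2, (min (q.1 : WithTop ℝ≥0) (exitTime (fun t (r : C(ℝ≥0, ℝ)) ↦ r t) a b q.2)).untopA))
      (u, p₀) :=
    continuousAt_snd.prodMk (continuousAt_stoppedClock hclean u)
  exact hev.continuousAt.comp h1

/-- The clean-exit hypothesis holds vacuously when the path never exits. [folklore] -/
theorem clean_of_exitTime_eq_top {p₀ : C(ℝ≥0, ℝ)}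
    (htop : exitTime (fun t (p : C(ℝ≥0, ℝ)) ↦ p t) a b p₀ = ⊤) :
    ∀ T : ℝ≥0, exitTime (fun t (p : C(ℝ≥0, ℝ)) ↦ p t) a b p₀ = T →
      ∀ ε : ℝ, 0 < ε → ∃ s : ℝ≥0, T < s ∧ (s : ℝ) < T + ε ∧ p₀ s ∉ Icc a b := by
  intro T hT
  rw [htop] at hT
  exact absurd hT WithTop.top_ne_coe

end PathSpace

end Literature.Probability.Process

end
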